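import Literature.NumberTheory.EllipticCurves.Kato2004.TateModuleFilAtInertia
import Literature.NumberTheory.EllipticCurves.TorsionFilAtCyclicOfFrobeniusTraceProofs
import Literature.NumberTheory.EllipticCurves.TorsionFilAtCardProofs
import Literature.NumberTheory.EllipticCurves.LocalPointsOrdinaryKummerCongruenceProofs
import Literature.NumberTheory.EllipticCurves.TateModuleFixedPointsProofs
import Literature.NumberTheory.GaloisRepresentations.LocalKroneckerWeberInertiaProofs
import HarnessLib

/-!
# The inertia action on the ordinary filtration `F⁺_v T_pE ⊂ T_pE` — DISCHARGED:
# `tateModuleFilAt_inertia_ordinary_holds`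

`Proofs` file (THEOREMS ONLY: no definition, no named fact, no instance, no `sorry`) in topic
`NumberTheory/EllipticCurves/Kato2004`, sibling of `TateModuleFilAtInertia.lean` (the named fact
`Kato2004.tateModuleFilAt_inertia_ordinary`, conv-1 GEN 31, p698222).  Cell `pub/bsd-2adic`, seat
`bsd-2adic-audit-2` GEN 62 (literature-prover; the R254.3 «literal → PROVED-by-name» road of the D-audit sheet
`audit/D-AUDIT-hTFI-Gr99-sec2-Gr91-sec2-SilvermanVII41-inertia-on-ordinary-filtration-at-2.md` §V5).

MATHEMATICS (R. Greenberg, *Iwasawa theory for motives*, LMS LNS 153 (1991) §2 p. 214; *Iwasawa theory for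
elliptic curves*, LNM 1716 (1999) §2; J. H. Silverman, *AEC* VII.2.1, VII.4.1 (proof), III.8.3): for `W/ℚ` globally
minimal with good ORDINARY reduction at `p`, `v` the place of `ℚ` over `p` and `σ` in the inertia group of `Γ_{ℚ_v}`,
(1) `σ a − a ∈ F⁺_v T_pW` for every `a ∈ T_pW` and (2) `σ a = χ_cyc(σ) • a` for every `a ∈ F⁺_v T_pW`, where
`F⁺_v T_pW = tateModuleFilAt W p v = T_p(E₁(ℚ̄_v))`.  The proof is assembled from tree theorems:

* (1) is the kernel theorem `WeierstrassCurve.smul_sub_mem_localKernelOfReduction_of_mem_absInertia` («`τ P − P ∈ E₁`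
  for `τ` in the inertia group at a place of good reduction», Silverman VII.4.1's displayed line) applied component by
  component (`absGaloisRestrict_smul_sub_mem_tateModuleFilAt`; any number field, any place of GOOD reduction — no
  ordinarity);
* (2): the tree's `ellipticOrdinaryReduction_tateModule_filtration_holds` (Greenberg 1991 §2 in `V_p`-currency: a
  `Γ_{ℚ_v}`-stable `ℚ_p`-line `L ⊂ V_pE` on which the inertia group acts through `χ_p` and such that it acts trivially
  on `V_pE/L`) is compared with `F := ℚ_p · ι(F⁺)` (`ι : T_p ↪ V_p`, `TateModule.toRational_injective`): by (1) the
  inertia group acts trivially on `V/F`; an inertia element `σ₀` with `χ_p(σ₀) = 1 + p` (local Kronecker–Weber,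
  `adicCompletion_rat_exists_mem_absInertia_cyclotomicCharacter_eq`) gives `p • ℓ = σ₀ ℓ − ℓ ∈ F` for `ℓ ∈ L`, so `L ≤ F`;
  `F ≠ V` because an ordinary point (`exists_ordinaryPoint_local_of_not_dvd_frobeniusTraceAt`, lifted to `E(ℚ̄)` by
  `exists_geomTorsion_pointsMapOfEmb_eq` and to `T_p` by `proj_surjective_of_isAlgClosed_holds`) lies outside the
  `p`-SATURATED (`tateModuleFilAt_saturated`) submodule `F⁺`; with `dim V = 2`
  (`finrank_rationalTateModule_eq_two_holds`) and `dim L = 1` this forces `F = L`, whence the scalar law on `F⁺`.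
  Bridges: `hasGoodReductionAtPrime_primesEquiv_iff_holds`, `frobeniusTraceAt_eq_frobeniusTrace`.

HONEST FRAMING: a classical theorem (Serre–Tate) assembled from tree theorems; nothing new is asserted; no summit
statement is touched; BSD is not proved by any of this.

## References
* [Greenberg1991] R. Greenberg, *Iwasawa theory for motives*, LMS LNS 153 (1991), §2 p. 214 (held
  `book:editornd-l-functions-arithmetic`, chunk p0183).
* [GreenbergLNM1716] R. Greenberg, *Iwasawa theory for elliptic curves*, LNM 1716 (1999), §2 (held
  `book:coates1999-arithmetic-theory-elliptic-curves`, chunks p0073, p0079).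
* [SilvermanAEC2009] J. H. Silverman, *The Arithmetic of Elliptic Curves*, 2nd ed. (2009), III.8.3, VII.2.1, VII.4.1.
-/

noncomputable section

open scoped NumberField
open Field IsDedekindDomain NumberField WeierstrassCurve
open Literature.NumberTheory.GaloisRepresentations
open Literature.NumberTheory.EllipticCurves Literature.NumberTheory.EllipticCurves.Kato2004
open Literature.NumberTheory.EllipticCurves.Kato2004.EulerSystemValues

namespace Literature.NumberTheory.EllipticCurves.Kato2004

universe u

/-! ## §1 Generalities: saturation of `F⁺`, denominators in `ℚ_p`-spans of integral submodules -/

section General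

variable {K : Type} [Field K] [NumberField K] (W : WeierstrassCurve K) (p : ℕ) [Fact p.Prime]
  (v : HeightOneSpectrum (𝓞 K))

/-- **`F⁺_v T_pE` is saturated for `p`-powers**: `p^k • a ∈ F⁺ → a ∈ F⁺` (the `n`-th component of `a` is the
`(k+n)`-th component of `p^k • a`, which lies in the kernel of reduction). [cite: SilvermanAEC2009, III.7 (Tate module)] -/
theorem tateModuleFilAt_saturated {a : W.tateModule p} (k : ℕ)
    (h : ((p : ℤ_[p]) ^ k • a) ∈ tateModuleFilAt W p v) : a ∈ tateModuleFilAt W p v := by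
  rw [mem_tateModuleFilAt_iff] at h ⊢
  intro n
  have := h (k + n)
  rwa [TateModule.proj_pow_smul, TateModule.pow_smul_proj_self_add] at this

/-- **Inertia moves every point of `T_pE` inside `F⁺_v T_pE`** at a place `v` of GOOD reduction: `τ a − a ∈ F⁺_v T_pE`
for `τ` in the inertia group of `Γ_{K_v}` — component by component this is «`τ P − P ∈ E₁(K̄_v)`» (Silverman, AEC
VII.4.1, proof: inertia acts trivially on `Ẽ(k̄)`), the tree's
`WeierstrassCurve.smul_sub_mem_localKernelOfReduction_of_mem_absInertia`. No ordinarity is needed.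
[cite: SilvermanAEC2009, VII.4 Thm. 4.1 (proof) and Prop. VII.2.1] [cite: GreenbergLNM1716, §2 (E[p^∞]/C_v unramified)] -/
theorem absGaloisRestrict_smul_sub_mem_tateModuleFilAt (hgood : W.HasGoodReductionAt v)
    {τ : absoluteGaloisGroup (v.adicCompletion K)} (hτ : τ ∈ absInertia (v.adicCompletion K))
    (a : W.tateModule p) :
    absGaloisRestrict K (v.adicCompletion K) τ • a - a ∈ tateModuleFilAt W p v := by
  rw [mem_tateModuleFilAt_iff]
  intro k
  rw [map_sub, map_sub, TateModule.proj_smul_of_distribMulAction, ← WeierstrassCurve.resGal_eq_absGaloisRestrict,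
    resGal_eq, pointsMapOfEmb_smul]
  exact W.smul_sub_mem_localKernelOfReduction_of_mem_absInertia hgood hτ _

end General

/-- Denominators in `ℚ_p`: every `c ∈ ℚ_p` has `p^m c ∈ ℤ_p` for some `m`. [folklore] -/
private theorem exists_pow_mul_eq_coe_padicInt (p : ℕ) [Fact p.Prime] (c : ℚ_[p]) :
    ∃ (m : ℕ) (d : ℤ_[p]), (p : ℚ_[p]) ^ m * c = d := by
  by_cases hc : c = 0
  · exact ⟨0, 0, by simp [hc]⟩
  have hcpos : 0 < ‖c‖ := norm_pos_iff.mpr hc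
  obtain ⟨k, hk⟩ := PadicInt.exists_pow_neg_lt p (ε := ‖c‖⁻¹) (inv_pos.mpr hcpos)
  refine ⟨k, ⟨(p : ℚ_[p]) ^ k * c, ?_⟩, rfl⟩
  rw [norm_mul, Padic.norm_p_pow]
  calc (p : ℝ) ^ (-(k : ℤ)) * ‖c‖ ≤ ‖c‖⁻¹ * ‖c‖ := mul_le_mul_of_nonneg_right hk.le hcpos.le
    _ = 1 := inv_mul_cancel₀ hcpos.ne'

/-- **Denominators in the `ℚ_p`-span of an integral submodule.**  For a `ℤ_p`-linear `ι : T → V` into a `ℚ_p`-space and a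
`ℤ_p`-submodule `N ≤ T`: every `y` in the `ℚ_p`-span of `ι(N)` has `p^n • y ∈ ι(N)` for some `n`. [folklore] -/
private theorem exists_pow_smul_eq_of_mem_span (p : ℕ) [Fact p.Prime] {T V : Type*} [AddCommGroup T] [Module ℤ_[p] T]
    [AddCommGroup V] [Module ℚ_[p] V] [Module ℤ_[p] V] [IsScalarTower ℤ_[p] ℚ_[p] V]
    (ι : T →ₗ[ℤ_[p]] V) (N : Submodule ℤ_[p] T) {y : V}
    (hy : y ∈ Submodule.span ℚ_[p] (ι '' (N : Set T))) :
    ∃ (n : ℕ) (x : T), x ∈ N ∧ ((p : ℚ_[p]) ^ n) • y = ι x := by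
  have hsc : ∀ (d : ℤ_[p]) (z : V), ((d : ℚ_[p])) • z = d • z := fun d z ↦ algebraMap_smul ℚ_[p] d z
  induction hy using Submodule.span_induction with
  | mem z hz =>
    obtain ⟨x, hx, rfl⟩ := hz
    exact ⟨0, x, hx, by simp⟩
  | zero => exact ⟨0, 0, N.zero_mem, by simp⟩
  | add y z _ _ hy hz =>
    obtain ⟨n₁, x₁, hx₁, h₁⟩ := hy
    obtain ⟨n₂, x₂, hx₂, h₂⟩ := hz
    refine ⟨n₁ + n₂, (p : ℤ_[p]) ^ n₂ • x₁ + (p : ℤ_[p]) ^ n₁ • x₂,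
      N.add_mem (N.smul_mem _ hx₁) (N.smul_mem _ hx₂), ?_⟩
    rw [smul_add, map_add, map_smul, map_smul, ← h₁, ← h₂, ← hsc, ← hsc, smul_smul, smul_smul]
    push_cast
    ring_nf
  | smul c y _ hy =>
    obtain ⟨n, x, hx, h⟩ := hy
    obtain ⟨m, d, hd⟩ := exists_pow_mul_eq_coe_padicInt p c
    refine ⟨m + n, d • x, N.smul_mem _ hx, ?_⟩
    rw [map_smul, ← hsc, ← h, smul_smul, smul_smul, ← hd]
    ring_nf

/-! ## §2 The discharge over `ℚ` -/

section Rat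

variable (W : WeierstrassCurve ℚ) [W.IsElliptic] [W.IsGloballyMinimal] (p : ℕ) [hp : Fact p.Prime]
  (v : HeightOneSpectrum (𝓞 ℚ))

/-- The place `v ∋ p` of `ℚ` is `(p)`: `primesEquiv v = p`. [folklore] -/
private theorem primesEquiv_eq_of_natCast_mem_asIdeal (hv : ((p : ℕ) : 𝓞 ℚ) ∈ v.asIdeal) :
    (Rat.HeightOneSpectrum.primesEquiv v : ℕ) = p := by
  have h1 : Rat.HeightOneSpectrum.natGenerator v ∣ p := by
    rw [Rat.HeightOneSpectrum.natGenerator_dvd_iff, Ideal.mem_map_of_equiv]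
    exact ⟨p, hv, map_natCast _ p⟩
  exact (Nat.prime_dvd_prime_iff_eq (Rat.HeightOneSpectrum.prime_natGenerator v) hp.out).mp h1

/-- Good ORDINARY reduction at `p` (`IsOrdinaryAt`: good at `p`, `p ∤ a_p`) in the place-indexed currency of the tree:
good reduction at `v ∋ p` and `p ∤ a_v` (`a_v = a_p` for a globally minimal equation). [cite: SilvermanAEC2009, VII.1 Prop. 1.3(b), VII.5 Prop. 5.1(a)] -/
theorem hasGoodReductionAt_and_not_dvd_frobeniusTraceAt_of_isOrdinaryAt (hord : IsOrdinaryAt W p)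
    (hv : ((p : ℕ) : 𝓞 ℚ) ∈ v.asIdeal) :
    W.HasGoodReductionAt v ∧ ¬ ((p : ℤ) ∣ W.frobeniusTraceAt v) := by
  have hvp := primesEquiv_eq_of_natCast_mem_asIdeal p v hv
  refine ⟨(hasGoodReductionAtPrime_primesEquiv_iff_holds W v p hvp).mp hord.1, ?_⟩
  rw [W.frobeniusTraceAt_eq_frobeniusTrace v]
  have : (Rat.HeightOneSpectrum.primesEquiv v : ℕ) = p := hvp
  -- `frobeniusTrace` at the `Nat.Primes`-indexed prime `primesEquiv v = ⟨p, _⟩`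
  have hq : Rat.HeightOneSpectrum.primesEquiv v = ⟨p, hp.out⟩ := Subtype.ext this
  rw [hq]
  exact hord.2

/-- **Greenberg 1991 §2 / LNM 1716 §2 at the integral level, DISCHARGED**: the named fact
`Kato2004.tateModuleFilAt_inertia_ordinary` holds. [cite: Greenberg1991, §2 (p. 214)] [cite: GreenbergLNM1716, §2]
[cite: SilvermanAEC2009, VII.2 Prop. 2.1, VII.4 Thm. 4.1 proof, III.8 Prop. 8.3] -/
theorem tateModuleFilAt_inertia_ordinary_holds : tateModuleFilAt_inertia_ordinary := by
  intro W _ _ p _ _ hord v hv σ hσ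
  classical
  obtain ⟨hgood, hordv⟩ := hasGoodReductionAt_and_not_dvd_frobeniusTraceAt_of_isOrdinaryAt W p v hord hv
  have hp : (p : ℕ).Prime := Fact.out
  -- (1) inertia acts trivially on `T/F⁺`
  have h1 : ∀ τ ∈ absInertia (v.adicCompletion ℚ), ∀ a : W.tateModule p,
      absGaloisRestrict ℚ (v.adicCompletion ℚ) τ • a - a ∈ tateModuleFilAt W p v := fun τ hτ a ↦
    absGaloisRestrict_smul_sub_mem_tateModuleFilAt W p v hgood hτ a
  refine ⟨fun a ↦ h1 σ hσ a, ?_⟩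
  -- notation
  set N : Submodule ℤ_[p] (W.tateModule p) := tateModuleFilAt W p v with hN
  let ι : W.tateModule p →ₗ[ℤ_[p]] W.rationalTateModule p := TateModule.toRational p
  let ρV := W.rationalGaloisRepTate p
  let res := absGaloisRestrict ℚ (v.adicCompletion ℚ)
  have hιρ : ∀ (g : absoluteGaloisGroup ℚ) (x : W.tateModule p), ρV g (ι x) = ι (g • x) :=
    fun g x ↦ rationalTateRepresentation_toRational _ _ p g x
  have hsc : ∀ (d : ℤ_[p]) (z : W.rationalTateModule p), ((d : ℚ_[p])) • z = d • z :=
    fun d z ↦ algebraMap_smul ℚ_[p] d z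
  have hιinj : Function.Injective ι := TateModule.toRational_injective
  -- the `V_p`-theorem of the tree (Greenberg 1991 §2)
  obtain ⟨L, hL1, -, hLχ, -⟩ :=
    ellipticOrdinaryReduction_tateModule_filtration_holds W p v hv hgood hordv
  -- `F := ℚ_p · ι(F⁺)`
  set F : Submodule ℚ_[p] (W.rationalTateModule p) :=
    Submodule.span ℚ_[p] (ι '' (N : Set (W.tateModule p))) with hF
  have hιN : ∀ x ∈ N, ι x ∈ F := fun x hx ↦ Submodule.subset_span ⟨x, hx, rfl⟩
  -- (i) inertia acts trivially on `V/F` (clear denominators: `d • y = ι x`, then (1) for `x`)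
  have hquotF : ∀ τ ∈ absInertia (v.adicCompletion ℚ), ∀ y : W.rationalTateModule p,
      ρV (res τ) y - y ∈ F := by
    intro τ hτ y
    obtain ⟨d, hd, x, hx⟩ := RationalTateModule.exists_smul_eq_toRational y
    have hd' : (d : ℚ_[p]) ≠ 0 := PadicInt.coe_ne_zero.mpr hd
    have hmem : ρV (res τ) ((d : ℚ_[p]) • y) - (d : ℚ_[p]) • y ∈ F := by
      rw [hx, hιρ, ← map_sub]
      exact hιN _ (h1 τ hτ x)
    rw [map_smul, ← smul_sub] at hmem
    have := F.smul_mem ((d : ℚ_[p]))⁻¹ hmem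
    rwa [smul_smul, inv_mul_cancel₀ hd', one_smul] at this
  -- (ii) `L ≤ F`, through an inertia element with `χ(σ₀) = 1 + p`
  obtain ⟨u₀, hu₀⟩ : ∃ u₀ : ℤ_[p]ˣ, (u₀ : ℤ_[p]) = 1 + p := by
    rcases IsLocalRing.isUnit_or_isUnit_one_sub_self (1 + (p : ℤ_[p])) with h | h
    · exact ⟨h.unit, h.unit_spec⟩
    · exfalso
      have h' : (1 : ℤ_[p]) - (1 + p) = -p := by ring
      rw [h', IsUnit.neg_iff] at h
      exact PadicInt.prime_p.not_unit h
  obtain ⟨σ₀, hσ₀I, hχ₀⟩ := adicCompletion_rat_exists_mem_absInertia_cyclotomicCharacter_eq p v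
    (primesEquiv_eq_of_natCast_mem_asIdeal p v hv) u₀
  have hp0 : (p : ℚ_[p]) ≠ 0 := Nat.cast_ne_zero.mpr hp.ne_zero
  have hLF : L ≤ F := by
    intro ℓ hℓ
    have h := hquotF σ₀ hσ₀I ℓ
    rw [hLχ σ₀ hσ₀I ℓ hℓ, hχ₀, hu₀] at h
    have hpℓ : (p : ℚ_[p]) • ℓ ∈ F := by
      have e : (((1 + p : ℤ_[p]) : ℚ_[p])) • ℓ - ℓ = (p : ℚ_[p]) • ℓ := by
        push_cast
        rw [add_smul, one_smul, add_sub_cancel_left]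
      rwa [e] at h
    have := F.smul_mem ((p : ℚ_[p])⁻¹) hpℓ
    rwa [smul_smul, inv_mul_cancel₀ hp0, one_smul] at this
  -- (iii) `F ≠ ⊤`: an ordinary point lies outside the saturated `F⁺`
  have hFtop : F ≠ ⊤ := by
    obtain ⟨P, hPp, hPE⟩ := W.exists_ordinaryPoint_local_of_not_dvd_frobeniusTraceAt v hgood hv hordv
    obtain ⟨Q, hQp, hQP⟩ := W.exists_geomTorsion_pointsMapOfEmb_eq v (p := p) 1 P (by simpa using hPp)
    obtain ⟨a, ha⟩ := W.proj_surjective_of_isAlgClosed_holds p 1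
      (P := Q) ((mem_geomTorsion_iff W _ Q).mpr (by exact_mod_cast hQp))
    intro htop
    have haF : ι a ∈ F := by rw [htop]; exact Submodule.mem_top
    obtain ⟨n, x, hx, hnx⟩ := exists_pow_smul_eq_of_mem_span p ι N haF
    have hna : ((p : ℤ_[p]) ^ n) • a ∈ N := by
      have e : ι (((p : ℤ_[p]) ^ n) • a) = ι x := by
        rw [map_smul, ← hnx, ← hsc]; push_cast; rfl
      rwa [← hιinj e] at hx
    have haN : a ∈ N := tateModuleFilAt_saturated W p v n hna
    -- component `1` of `a` is `Q`, whose image in `E(ℚ̄_v)` is the ordinary point `P ∉ E₁`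
    have := (mem_tateModuleFilAt_iff W p v a).mp haN 1
    rw [ha, hQP] at this
    exact hPE this
  -- (iv) dimension count: `dim V = 2`, `dim L = 1`, `L ≤ F < ⊤` ⇒ `F = L`
  have hV2 : Module.finrank ℚ_[p] (W.rationalTateModule p) = 2 :=
    W.finrank_rationalTateModule_eq_two_holds p (Nat.cast_ne_zero.mpr hp.ne_zero)
  haveI : Module.Finite ℚ_[p] (W.rationalTateModule p) := Module.finite_of_finrank_eq_succ hV2
  have hFlt : Module.finrank ℚ_[p] F < 2 := hV2 ▸ Submodule.finrank_lt hFtop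
  have hLle : Module.finrank ℚ_[p] L ≤ Module.finrank ℚ_[p] F := Submodule.finrank_mono hLF
  have hLeqF : L = F := Submodule.eq_of_le_of_finrank_eq hLF (by omega)
  -- (v) the scalar law on `F⁺`
  intro a ha
  have hιa : ι a ∈ L := hLeqF ▸ hιN a ha
  have key := hLχ σ hσ (ι a) hιa
  rw [hιρ, hsc, ← map_smul] at key
  exact hιinj key

end Rat

end Literature.NumberTheory.EllipticCurves.Kato2004

end
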